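import Summits.BirchSwinnertonDyer.BirchSwinnertonDyer.Theorems.AdditiveKolyvaginRoadTwoIsotropicPlanes
import Summits.BirchSwinnertonDyer.BirchSwinnertonDyer.Theorems.AdditiveKolyvaginRoadTwoPlaceLagrangian
import Summits.BirchSwinnertonDyer.BirchSwinnertonDyer.Theorems.AdditiveKolyvaginRoadTwoPrimeJumpPrelims
import Summits.BirchSwinnertonDyer.BirchSwinnertonDyer.Theorems.AdditiveKolyvaginRoadLevelBasics
import Summits.BirchSwinnertonDyer.BirchSwinnertonDyer.Theorems.AdditiveKolyvaginRoadLocalFrobenius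
import Summits.BirchSwinnertonDyer.BirchSwinnertonDyer.Theorems.AdditiveKolyvaginRoadToricDictionary
import HarnessLib

/-!
# Route `AdditiveKolyvaginRoad`, crux `KolyvaginPrimitiveAdditive` (item stmt-BirchSwinnertonDyer-21400), stub J2
# (`stub_twoPrimeJumpAdditive`, skeleton v10) FROM THE POITOU–TATE FACT: the two-prime jump at Bertolini–Darmon
# admissible primes — `dim Sel_{q₁q₂}^ε = 1` and `Sel_{q₁q₂}^{¬ε} = Sel_∅^{¬ε}` when `Sel_∅^ε = 𝔽_p x` and `q₁ ≠ q₂` detect `x`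
# (cell `pub/bsd-wall`, lead prover `bsd-wall-akr-p1` g5; `--supports stmt-BirchSwinnertonDyer-21400`, helper)

WHAT. `twoPrimeJump_of_poitouTate`: the binder `hJ2` of akr-p2x's `kolyvaginPrimitive_of_levelSystem_of_rankOne`
(p567709), VERBATIM — for `K` imaginary quadratic, `p ≥ 5`, complex conjugation `c ≠ 1` and the named fact
`poitouTate_selmerStructure_duality K`. Proof (W. Zhang Lemma 5.3 ∕ Prop. 5.4 at two primes — «lower at `q₁`, raise at
`q₂`» — done at once): (i) each `q_i` detects the `ε`-class `x`, so its sign is `ε` and every `¬ε`-class dies at `v₁, v₂`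
(sibling `…TwoPrimeJumpPrelims`: conjunct 2); (ii) the `{v₁, v₂}`-relaxed Kummer group `R = kummerOutside E p {v₁, v₂}` is
`c`-stable and every class is an `ε`-class plus a `¬ε`-class, the latter invisible at `v₁, v₂`
(`exists_eigen_of_mem_kummerOutside_pair`); (iii) the image `Λ` of `R` in `H¹(K_{v₁}, E[p]) ⊕ H¹(K_{v₂}, E[p])` is Lagrangian
of order `p²` (sibling `…TwoPlaceLagrangian`, Poitou–Tate) and `Λ ∩ (F₁ ⊕ F₂) ⊆ ℤ · loc x` since an `ε`-class Kummer at
`v₁, v₂` is a Selmer class, a multiple of `x`; (iv) the two-plane lemma (sibling `…TwoIsotropicPlanes`: symmetric local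
Weil pairing, Kummer and toric Lagrangian lines) gives `#(Λ ∩ (T₁ ⊕ T₂)) = p`; (v) `Sel_{q₁q₂}^ε ≅ Λ ∩ (T₁ ⊕ T₂)` along the
localisation, injective on `ε`-classes Kummer at `v₁` because `Sel_∅^ε ∩ ker loc_{v₁} = 0` (`natCard_selQP_pair_eq`).

HONEST FRAMING: theorems only; 0 definitions, 0 named facts, 0 `sorry`; CONDITIONAL on the named PT fact (binder);
closes nothing by itself (stub J2 is «closed modulo DUAL.2», like LOC).

References: [cite: WZhang2014, Lemma 5.3, Prop. 5.4, §9 (9.2)] [cite: BertoliniDarmon2005, Lemma 2.6, §2.3]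
[cite: MilneADT2006, Ch. I, Cor. 2.3, Thm. 4.10] [cite: Howard2004HeegnerKolyvagin, Thm. 2.1.11]
[cite: KlagsbrunMazurRubin2013, Thm. 3.1 (i)] [cite: GrossLMS1991, §5 (5.1)].
-/

-- single-conjunct summit: `Summit.BirchSwinnertonDyer.BirchSwinnertonDyer.…` repeats the name by design
set_option linter.dupNamespace false

noncomputable section

open scoped Classical NumberField
open Function NumberField IsDedekindDomain Field WeierstrassCurve Module
open Literature.NumberTheory.EllipticCurves Literature.NumberTheory.EllipticCurves.ModularForms
open Literature.NumberTheory.GaloisRepresentations Literature.NumberTheory.GaloisRepresentations.DiscreteGaloisModule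
  Literature.NumberTheory.GaloisCohomology
open Summit.BirchSwinnertonDyer.Rank1Residual.X11b Summit.BirchSwinnertonDyer.Rank1Residual.X11b.Relaxation

namespace Summit.BirchSwinnertonDyer.BirchSwinnertonDyer.Theorems.AdditiveKoly

variable (W : WeierstrassCurve ℚ) (K : Type) [Field K] [NumberField K] (p : ℕ) (c : K ≃ₐ[ℚ] K)
  [W.IsElliptic] [W.IsGloballyMinimal] [Fact p.Prime]

/-! ## §1 Every class of the relaxed group is an `ε`-class up to a class invisible at `v₁, v₂` -/

/-- **Eigen-reduction inside `R = kummerOutside E p {v₁, v₂}`**: if the `ε`-class `x` is detected at both places, every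
`y ∈ R` has an `ε`-class `y₁ ∈ R` with the same localisations at `v₁` and `v₂` (the `¬ε`-part of `y` dies there).
[cite: WZhang2014, §9 (9.2)] [cite: GrossLMS1991, §5 (5.1)] -/
theorem exists_eigen_of_mem_kummerOutside_pair (h5 : 5 ≤ p) (hK : IsImaginaryQuadratic K) (hc1 : c ≠ 1)
    (q₁ q₂ : AdmQ W K p) (v₁ v₂ : HeightOneSpectrum (𝓞 K)) (hv₁ : ((q₁ : ℕ) : 𝓞 K) ∈ v₁.asIdeal)
    (hv₂ : ((q₂ : ℕ) : 𝓞 K) ∈ v₂.asIdeal) {ε : Bool} {x : Vp W K p}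
    (hx : conjAct W c ((p ^ 1 : ℕ) : ℤ) x = sgnP ε • x)
    (hdet₁ : x ∉ (W.baseChange K).torsionLocalKer (v₁.adicCompletion K) ((p ^ 1 : ℕ) : ℤ))
    (hdet₂ : x ∉ (W.baseChange K).torsionLocalKer (v₂.adicCompletion K) ((p ^ 1 : ℕ) : ℤ)) (y : Vp W K p)
    (hy : y ∈ kummerOutside (W.baseChange K) (p ^ 1) ({Sum.inr v₁, Sum.inr v₂} : Finset (Place K))) :
    ∃ y₁ : Vp W K p, y₁ ∈ kummerOutside (W.baseChange K) (p ^ 1) ({Sum.inr v₁, Sum.inr v₂} : Finset (Place K)) ∧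
      conjAct W c ((p ^ 1 : ℕ) : ℤ) y₁ = sgnP ε • y₁ ∧
      galoisCohomology.localization ((W.baseChange K).torsionGaloisModule ((p ^ 1 : ℕ) : ℤ)) (Sum.inr v₁) 1 y =
        galoisCohomology.localization ((W.baseChange K).torsionGaloisModule ((p ^ 1 : ℕ) : ℤ)) (Sum.inr v₁) 1 y₁ ∧
      galoisCohomology.localization ((W.baseChange K).torsionGaloisModule ((p ^ 1 : ℕ) : ℤ)) (Sum.inr v₂) 1 y =
        galoisCohomology.localization ((W.baseChange K).torsionGaloisModule ((p ^ 1 : ℕ) : ℤ)) (Sum.inr v₂) 1 y₁ := by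
  have hp : p.Prime := Fact.out
  have hpodd : Odd p := hp.odd_of_ne_two (by omega)
  have hcc : c * c = 1 := by
    haveI : Algebra.IsQuadraticExtension ℚ K := ⟨hK.1⟩
    have hcard : Nat.card (K ≃ₐ[ℚ] K) = 2 := by rw [IsGalois.card_aut_eq_finrank, hK.1]
    haveI : Finite (K ≃ₐ[ℚ] K) := Nat.finite_of_card_ne_zero (by rw [hcard]; decide)
    have h : c ^ Nat.card (K ≃ₐ[ℚ] K) = 1 := pow_card_eq_one'
    rwa [hcard, sq] at h
  obtain ⟨y₁, hy₁, y₂, -, hτ₁, hτ₂, hsum⟩ := exists_eigen_decomposition W K p hpodd (conjAct W c ((p ^ 1 : ℕ) : ℤ))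
    (conjAct_conjAct_of_mul_self W hcc ((p ^ 1 : ℕ) : ℤ)) _
    (fun z hz ↦ conjAct_mem_kummerOutside_pair W K p c hK q₁ q₂ v₁ v₂ hv₁ hv₂ hz) ε hy
  have h0₁ := (mem_torsionLocalKer_iff_localization_eq_zero_P W K p v₁ y₂).mp
    (mem_torsionLocalKer_of_sign_ne W K p c hpodd hK.1 hc1 q₁ v₁ hv₁ hx hdet₁ hτ₂)
  have h0₂ := (mem_torsionLocalKer_iff_localization_eq_zero_P W K p v₂ y₂).mp
    (mem_torsionLocalKer_of_sign_ne W K p c hpodd hK.1 hc1 q₂ v₂ hv₂ hx hdet₂ hτ₂)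
  -- the localisations, as functions on `H¹(K, E[p])` in the route's currency (`Vp`)
  set loc₁ : Vp W K p → _ := fun z : Vp W K p ↦
    galoisCohomology.localization ((W.baseChange K).torsionGaloisModule ((p ^ 1 : ℕ) : ℤ)) (Sum.inr v₁) 1 z with hloc₁
  set loc₂ : Vp W K p → _ := fun z : Vp W K p ↦
    galoisCohomology.localization ((W.baseChange K).torsionGaloisModule ((p ^ 1 : ℕ) : ℤ)) (Sum.inr v₂) 1 z with hloc₂
  have e₁ : loc₁ (y₁ + y₂) = loc₁ y₁ + loc₁ y₂ := map_add _ y₁ y₂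
  have e₂ : loc₂ (y₁ + y₂) = loc₂ y₁ + loc₂ y₂ := map_add _ y₁ y₂
  refine ⟨y₁, hy₁, hτ₁, ?_, ?_⟩
  · change loc₁ y = loc₁ y₁
    rw [← hsum, e₁, show loc₁ y₂ = 0 from h0₁, add_zero]
  · change loc₂ y = loc₂ y₁
    rw [← hsum, e₂, show loc₂ y₂ = 0 from h0₂, add_zero]

/-! ## §2 `#Sel_{q₁q₂}^ε = p` from the two-place Lagrangian and the two-plane lemma -/

/-- **`#Sel_{q₁q₂}^ε = p`** under the hypotheses of J2 (the heart of conjunct 1). See the module docstring, steps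
(ii)–(v). [cite: WZhang2014, Lemma 5.3, Prop. 5.4] [cite: MilneADT2006, Ch. I, Thm. 4.10] [cite: KlagsbrunMazurRubin2013,
Thm. 3.1 (i)] -/
theorem natCard_selQP_pair_eq [Module (ZMod p) (Vp W K p)] (h5 : 5 ≤ p) (hK : IsImaginaryQuadratic K) (hc1 : c ≠ 1)
    (hPT : poitouTate_selmerStructure_duality K) (ε : Bool) (x : Vp W K p) (q₁ q₂ : AdmQ W K p)
    (v₁ v₂ : HeightOneSpectrum (𝓞 K)) (hx : x ∈ SelQP W K p c ∅ ε)
    (hline : ∀ y ∈ SelQP W K p c ∅ ε, ∃ a : ZMod p, y = a • x) (hq12 : q₁ ≠ q₂)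
    (hv₁ : ((q₁ : ℕ) : 𝓞 K) ∈ v₁.asIdeal)
    (hdet₁ : x ∉ (W.baseChange K).torsionLocalKer (v₁.adicCompletion K) ((p ^ 1 : ℕ) : ℤ))
    (hv₂ : ((q₂ : ℕ) : 𝓞 K) ∈ v₂.asIdeal)
    (hdet₂ : x ∉ (W.baseChange K).torsionLocalKer (v₂.adicCompletion K) ((p ^ 1 : ℕ) : ℤ)) :
    Nat.card (SelQP W K p c {q₁, q₂} ε) = p := by
  have hp : p.Prime := Fact.out
  have hp2 : p ≠ 2 := by omega
  haveI : NeZero (p ^ 1 : ℕ) := ⟨pow_ne_zero 1 hp.ne_zero⟩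
  haveI : Fact (Nat.Prime (p ^ 1)) := ⟨by rw [pow_one]; exact hp⟩
  haveI : ∀ v : Place K, CompactSpace (absoluteGaloisGroup (Place.Completion v)) := fun v ↦
    absoluteGaloisGroup_compactSpace _
  haveI : Finite (geomTorsion (W.baseChange K) ((p ^ 1 : ℕ) : ℤ)) := finite_geomTorsion_of_neZero (W.baseChange K) (p ^ 1)
  have hv12 : v₁ ≠ v₂ := place_ne_of_admQ_ne W K p hq12 hv₁ hv₂
  have hxε : conjAct W c ((p ^ 1 : ℕ) : ℤ) x = sgnP ε • x := ((mem_selQP_iff W K p c ∅ ε x).mp hx).1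
  -- the Poitou–Tate family at level `p` and a Weil pairing on `E[p]`
  obtain ⟨inv, hperf, hsum, -, hcompl⟩ := hPT (p ^ 1)
  obtain ⟨e, hμ, hadd₁, hadd₂, halt, hnondeg, hgal⟩ :=
    exists_weilPairing_holds (W.baseChange K) (p ^ 1) (by rw [pow_one]; exact hp.two_le) (by
      exact_mod_cast pow_ne_zero 1 hp.ne_zero)
  -- notation: the relaxed group, the two localisations, the image, the local lines
  set R := kummerOutside (W.baseChange K) (p ^ 1) ({Sum.inr v₁, Sum.inr v₂} : Finset (Place K)) with hR
  set loc₁ := galoisCohomology.localization ((W.baseChange K).torsionGaloisModule ((p ^ 1 : ℕ) : ℤ)) (Sum.inr v₁) 1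
    with hloc₁
  set loc₂ := galoisCohomology.localization ((W.baseChange K).torsionGaloisModule ((p ^ 1 : ℕ) : ℤ)) (Sum.inr v₂) 1
    with hloc₂
  set L := loc₁.prod loc₂ with hL
  set Λ := R.map L with hΛ
  set F₁ := (W.baseChange K).kummerSelmerStructure ((p ^ 1 : ℕ) : ℤ) (Sum.inr v₁) with hF₁
  set F₂ := (W.baseChange K).kummerSelmerStructure ((p ^ 1 : ℕ) : ℤ) (Sum.inr v₂) with hF₂
  set T₁ : AddSubgroup (galoisCohomology (((W.baseChange K).torsionGaloisModule ((p ^ 1 : ℕ) : ℤ)).toLocal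
      (Sum.inr v₁)) 1) := toricLocalCondition (W.baseChange K) (v₁.adicCompletion K) ((p ^ 1 : ℕ) : ℤ) with hT₁
  set T₂ : AddSubgroup (galoisCohomology (((W.baseChange K).torsionGaloisModule ((p ^ 1 : ℕ) : ℤ)).toLocal
      (Sum.inr v₂)) 1) := toricLocalCondition (W.baseChange K) (v₂.adicCompletion K) ((p ^ 1 : ℕ) : ℤ) with hT₂
  -- dictionaries global ↔ model currency at `v₁, v₂`
  have dK₁ : ∀ y : Vp W K p, y ∈ selmerLocalKer (W.baseChange K) (v₁.adicCompletion K) ((p ^ 1 : ℕ) : ℤ) ↔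
      (L y).1 ∈ F₁ := fun y ↦ by
    rw [hF₁, WeierstrassCurve.kummerSelmerStructure_apply]
    exact mem_selmerLocalKer_iff_localization_mem_kummer_P W K p v₁ y
  have dK₂ : ∀ y : Vp W K p, y ∈ selmerLocalKer (W.baseChange K) (v₂.adicCompletion K) ((p ^ 1 : ℕ) : ℤ) ↔
      (L y).2 ∈ F₂ := fun y ↦ by
    rw [hF₂, WeierstrassCurve.kummerSelmerStructure_apply]
    exact mem_selmerLocalKer_iff_localization_mem_kummer_P W K p v₂ y
  have dT₁ : ∀ y : Vp W K p, y ∈ toricLocalKer (W.baseChange K) (v₁.adicCompletion K) ((p ^ 1 : ℕ) : ℤ) ↔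
      (L y).1 ∈ T₁ := fun y ↦
    mem_toricLocalKer_iff_res_mem_toricLocalCondition (W.baseChange K) (p ^ 1) (v₁.adicCompletion K) y
  have dT₂ : ∀ y : Vp W K p, y ∈ toricLocalKer (W.baseChange K) (v₂.adicCompletion K) ((p ^ 1 : ℕ) : ℤ) ↔
      (L y).2 ∈ T₂ := fun y ↦
    mem_toricLocalKer_iff_res_mem_toricLocalCondition (W.baseChange K) (p ^ 1) (v₂.adicCompletion K) y
  have dZ₁ : ∀ y : Vp W K p, y ∈ (W.baseChange K).torsionLocalKer (v₁.adicCompletion K) ((p ^ 1 : ℕ) : ℤ) ↔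
      (L y).1 = 0 := fun y ↦ mem_torsionLocalKer_iff_localization_eq_zero_P W K p v₁ y
  -- eigen-reduction in `R` (the `¬ε`-part is invisible at `v₁, v₂`)
  have hdec : ∀ y : Vp W K p, y ∈ R → ∃ y₁ : Vp W K p, y₁ ∈ R ∧ conjAct W c ((p ^ 1 : ℕ) : ℤ) y₁ = sgnP ε • y₁ ∧
      L y = L y₁ := fun y hy ↦ by
    obtain ⟨y₁, hy₁, hτ₁, h₁, h₂⟩ := exists_eigen_of_mem_kummerOutside_pair W K p c h5 hK hc1 q₁ q₂ v₁ v₂ hv₁ hv₂ hxε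
      hdet₁ hdet₂ y hy
    exact ⟨y₁, hy₁, hτ₁, Prod.ext h₁ h₂⟩
  -- `x`: in `R`, Kummer at `v₁, v₂`; `L x ∈ Λ ∩ (F₁ × F₂)`, off `T₁` and `T₂`
  obtain ⟨-, hxR, hxK₁, hxK₂⟩ := (mem_selQP_empty_iff_pair W K p c v₁ v₂ ε x).mp hx
  have hxΛ : L x ∈ Λ := AddSubgroup.mem_map_of_mem L hxR
  have hxT₁ : (L x).1 ∉ T₁ := fun h ↦ hdet₁ (localTrans_of_admQ W K p q₁ v₁ hv₁ x x hxK₁ ((dT₁ x).mpr h)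
    ⟨1, by rw [one_zsmul]⟩)
  have hxT₂ : (L x).2 ∉ T₂ := fun h ↦ hdet₂ (localTrans_of_admQ W K p q₂ v₂ hv₂ x x hxK₂ ((dT₂ x).mpr h)
    ⟨1, by rw [one_zsmul]⟩)
  -- a `ZMod p`-multiple of `x` is an integer multiple; one locally trivial at `v₁` is zero
  have hzsmul : ∀ (a : ZMod p) (y : Vp W K p), a • y = (a.cast : ℤ) • y := fun a y ↦ by
    conv_lhs => rw [← ZMod.intCast_zmod_cast a]
    exact Int.cast_smul_eq_zsmul (ZMod p) _ y
  have hax : ∀ a : ZMod p, a • x ∈ (W.baseChange K).torsionLocalKer (v₁.adicCompletion K) ((p ^ 1 : ℕ) : ℤ) →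
      a • x = 0 := fun a ha ↦ by
    by_cases ha0 : a = 0
    · rw [ha0, zero_smul]
    · exfalso
      have hx' : x = a⁻¹ • (a • x) := by rw [smul_smul, inv_mul_cancel₀ ha0, one_smul]
      exact hdet₁ (hx' ▸ ZMod.smul_mem ha a⁻¹)
  -- `Λ ∩ (F₁ × F₂) ⊆ ℤ · L x`
  have hlineΛ : ∀ l ∈ Λ, l.1 ∈ F₁ → l.2 ∈ F₂ → ∃ k : ℤ, l = k • L x := by
    rintro _ ⟨y, hyR, rfl⟩ h1 h2
    obtain ⟨y₁, hy₁R, hτ₁, hLy⟩ := hdec y hyR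
    have h1' : (L y₁).1 ∈ F₁ := by rw [← hLy]; exact h1
    have h2' : (L y₁).2 ∈ F₂ := by rw [← hLy]; exact h2
    have hy₁S : y₁ ∈ SelQP W K p c ∅ ε :=
      (mem_selQP_empty_iff_pair W K p c v₁ v₂ ε y₁).mpr ⟨hτ₁, hy₁R, (dK₁ y₁).mpr h1', (dK₂ y₁).mpr h2'⟩
    obtain ⟨a, rfl⟩ := hline y₁ hy₁S
    refine ⟨a.cast, ?_⟩
    have e : L ((a.cast : ℤ) • x) = (a.cast : ℤ) • L x := map_zsmul L _ x
    calc L y = L (a • x) := hLy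
      _ = L ((a.cast : ℤ) • x) := by rw [hzsmul]
      _ = (a.cast : ℤ) • L x := e
  -- the two-plane lemma at the prime `p = p ^ 1`
  obtain ⟨hΛiso, -⟩ := lagrangian_image_kummerOutside_pair W K p e hμ hadd₁ hadd₂ halt hnondeg hgal inv hK hperf hsum
    hcompl v₁ v₂ hv12
  have hp12 : p ^ 1 ≠ 2 := by rw [pow_one]; exact hp2
  have hsq : ∀ {m : ℕ}, m = p ^ 2 → m = (p ^ 1) ^ 2 := fun h ↦ by rw [h, pow_one]
  have hone : ∀ {m : ℕ}, m = p → m = p ^ 1 := fun h ↦ by rw [h, pow_one]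
  have hΛcard : Nat.card Λ = (p ^ 1) ^ 2 :=
    hsq (natCard_image_kummerOutside_pair W K p inv hK hperf hsum hcompl q₁ q₂ v₁ v₂ hv12 hv₁ hv₂)
  have hM : Nat.card (Λ ⊓ T₁.prod T₂ : AddSubgroup _) = p ^ 1 :=
    TwoPlanes.natCard_inf_prod_eq (p := p ^ 1) hp12
      (KummerPT.nsmul_galoisCohomology_toLocal_eq_zero (W.baseChange K) (p ^ 1) (Sum.inr v₁))
      (KummerPT.nsmul_galoisCohomology_toLocal_eq_zero (W.baseChange K) (p ^ 1) (Sum.inr v₂))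
      (hsq (natCard_localH1_eq_sq_of_admQ W K p hK.1 q₁ v₁ hv₁))
      (hsq (natCard_localH1_eq_sq_of_admQ W K p hK.1 q₂ v₂ hv₂))
      (invWeilPairing (W.baseChange K) (p ^ 1) e hμ hadd₁ hadd₂ hgal inv (Sum.inr v₁))
      (invWeilPairing (W.baseChange K) (p ^ 1) e hμ hadd₁ hadd₂ hgal inv (Sum.inr v₂))
      (invWeilPairing_symm_P W K p e hμ hadd₁ hadd₂ halt hgal inv (Sum.inr v₁))
      (invWeilPairing_symm_P W K p e hμ hadd₁ hadd₂ halt hgal inv (Sum.inr v₂))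
      (invWeilPairing_right_nondegenerate_P W K p e hμ hadd₁ hadd₂ hnondeg hgal inv v₁ (hperf v₁).1.1)
      (invWeilPairing_right_nondegenerate_P W K p e hμ hadd₁ hadd₂ hnondeg hgal inv v₂ (hperf v₂).1.1)
      F₁ T₁ F₂ T₂
      (hone (natCard_kummer_eq_of_admQ W K p hK q₁ v₁ hv₁)) (hone (natCard_toric_eq_of_admQ W K p hK q₁ v₁ hv₁))
      (hone (natCard_kummer_eq_of_admQ W K p hK q₂ v₂ hv₂)) (hone (natCard_toric_eq_of_admQ W K p hK q₂ v₂ hv₂))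
      (kummer_isotropic_P W K p e hμ hadd₁ hadd₂ halt hgal inv (Sum.inr v₁))
      (toric_isotropic_P W K p e hμ hadd₁ hadd₂ halt hgal inv hK.1 q₁ v₁ hv₁)
      (kummer_isotropic_P W K p e hμ hadd₁ hadd₂ halt hgal inv (Sum.inr v₂))
      (toric_isotropic_P W K p e hμ hadd₁ hadd₂ halt hgal inv hK.1 q₂ v₂ hv₂)
      Λ hΛcard hΛiso (L x) hxΛ ((dK₁ x).mp hxK₁) ((dK₂ x).mp hxK₂) hxT₁ hxT₂ hlineΛ
  -- `Sel_{q₁q₂}^ε ≅ Λ ∩ (T₁ × T₂)` along `L`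
  have hto : ∀ y ∈ SelQP W K p c {q₁, q₂} ε, L y ∈ (Λ ⊓ T₁.prod T₂ : AddSubgroup _) := fun y hy ↦ by
    obtain ⟨-, hyR, hyT₁, hyT₂⟩ := (mem_selQP_pair_iff W K p c q₁ q₂ v₁ v₂ hv₁ hv₂ ε y).mp hy
    exact AddSubgroup.mem_inf.mpr ⟨AddSubgroup.mem_map_of_mem L hyR,
      AddSubgroup.mem_prod.mpr ⟨(dT₁ y).mp hyT₁, (dT₂ y).mp hyT₂⟩⟩
  let Φ : SelQP W K p c {q₁, q₂} ε → (Λ ⊓ T₁.prod T₂ : AddSubgroup _) :=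
    fun y ↦ ⟨L (y : Vp W K p), hto (y : Vp W K p) y.2⟩
  have hΦval : ∀ y : SelQP W K p c {q₁, q₂} ε, (Φ y : _ × _) = L (y : Vp W K p) := fun _ ↦ rfl
  have hΦinj : Injective Φ := by
    rintro ⟨y, hy⟩ ⟨y', hy'⟩ h
    have h' : L y = L y' := by rw [← hΦval ⟨y, hy⟩, ← hΦval ⟨y', hy'⟩, h]
    have hd : L (y - y') = 0 := by
      have e : L (y - y') = L y - L y' := map_sub L y y'
      rw [e, h', sub_self]
    obtain ⟨hτd, hdR, -, -⟩ := (mem_selQP_pair_iff W K p c q₁ q₂ v₁ v₂ hv₁ hv₂ ε _).mp (Submodule.sub_mem _ hy hy')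
    have hZ₁ : y - y' ∈ (W.baseChange K).torsionLocalKer (v₁.adicCompletion K) ((p ^ 1 : ℕ) : ℤ) :=
      (dZ₁ _).mpr (congrArg Prod.fst hd)
    have hZ₂ : y - y' ∈ (W.baseChange K).torsionLocalKer (v₂.adicCompletion K) ((p ^ 1 : ℕ) : ℤ) :=
      (mem_torsionLocalKer_iff_localization_eq_zero_P W K p v₂ _).mpr (congrArg Prod.snd hd)
    have hd0 : y - y' ∈ SelQP W K p c ∅ ε := (mem_selQP_empty_iff_pair W K p c v₁ v₂ ε _).mpr
      ⟨hτd, hdR, (kummer_and_toric_of_mem_torsionLocalKer W K p v₁ hZ₁).1,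
        (kummer_and_toric_of_mem_torsionLocalKer W K p v₂ hZ₂).1⟩
    obtain ⟨a, ha⟩ := hline _ hd0
    have : y - y' = 0 := by rw [ha]; exact hax a (ha ▸ hZ₁)
    exact Subtype.ext (sub_eq_zero.mp this)
  have hΦsurj : Surjective Φ := by
    rintro ⟨l, hl⟩
    obtain ⟨hlΛ, hlT⟩ := AddSubgroup.mem_inf.mp hl
    obtain ⟨y, hyR, rfl⟩ := hlΛ
    obtain ⟨y₁, hy₁R, hτ₁, hLy⟩ := hdec y hyR
    have hlT' : L y₁ ∈ T₁.prod T₂ := by rw [← hLy]; exact hlT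
    rw [AddSubgroup.mem_prod] at hlT'
    have hy₁S : y₁ ∈ SelQP W K p c {q₁, q₂} ε := (mem_selQP_pair_iff W K p c q₁ q₂ v₁ v₂ hv₁ hv₂ ε y₁).mpr
      ⟨hτ₁, hy₁R, (dT₁ y₁).mpr hlT'.1, (dT₂ y₁).mpr hlT'.2⟩
    refine ⟨⟨y₁, hy₁S⟩, Subtype.ext ?_⟩
    rw [hΦval]
    exact hLy.symm
  rw [Nat.card_congr (Equiv.ofBijective Φ ⟨hΦinj, hΦsurj⟩), hM, pow_one]

/-! ## §3 The two-prime jump -/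

/-- **STUB J2 OF SKELETON v10 FROM THE POITOU–TATE FACT — THE TWO-PRIME JUMP** (the binder `hJ2` of
`kolyvaginPrimitive_of_levelSystem_of_rankOne`, p567709, VERBATIM): `K` imaginary quadratic, `p ≥ 5`, complex
conjugation `c ≠ 1`, `poitouTate_selmerStructure_duality K`; for an `ε`-class `x` spanning `Sel_∅^ε` and admissible
`q₁ ≠ q₂` whose places `v₁, v₂` detect `x`: `dim_{𝔽_p} Sel_{q₁q₂}^ε = 1` (`natCard_selQP_pair_eq`) and
`Sel_{q₁q₂}^{¬ε} = Sel_∅^{¬ε}` (`selQP_pair_not_eq`). [cite: WZhang2014, Lemma 5.3, Prop. 5.4, §9 (9.2)]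
[cite: MilneADT2006, Ch. I, Thm. 4.10] [cite: KlagsbrunMazurRubin2013, Thm. 3.1 (i)] -/
theorem twoPrimeJump_of_poitouTate (h5 : 5 ≤ p) (hK : IsImaginaryQuadratic K) (hc1 : c ≠ 1)
    (hPT : poitouTate_selmerStructure_duality K) [Module (ZMod p) (Vp W K p)] :
    ∀ (ε : Bool) (x : Vp W K p) (q₁ q₂ : AdmQ W K p) (v₁ v₂ : HeightOneSpectrum (𝓞 K)),
      x ∈ SelQP W K p c ∅ ε → x ≠ 0 → (∀ y ∈ SelQP W K p c ∅ ε, ∃ a : ZMod p, y = a • x) → q₁ ≠ q₂ →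
      ((q₁ : ℕ) : 𝓞 K) ∈ v₁.asIdeal →
      x ∉ (W.baseChange K).torsionLocalKer (v₁.adicCompletion K) ((p ^ 1 : ℕ) : ℤ) →
      ((q₂ : ℕ) : 𝓞 K) ∈ v₂.asIdeal →
      x ∉ (W.baseChange K).torsionLocalKer (v₂.adicCompletion K) ((p ^ 1 : ℕ) : ℤ) →
      finrank (ZMod p) (SelQP W K p c {q₁, q₂} ε) = 1 ∧
        SelQP W K p c {q₁, q₂} (!ε) = SelQP W K p c ∅ (!ε) := by
  intro ε x q₁ q₂ v₁ v₂ hx _ hline hq12 hv₁ hdet₁ hv₂ hdet₂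
  have hp : p.Prime := Fact.out
  have hpodd : Odd p := hp.odd_of_ne_two (by omega)
  refine ⟨?_, selQP_pair_not_eq W K p c hpodd hK.1 hc1 q₁ q₂ v₁ v₂ hv₁ hv₂ ((mem_selQP_iff W K p c ∅ ε x).mp hx).1
    hdet₁ hdet₂⟩
  have hcard := natCard_selQP_pair_eq W K p c h5 hK hc1 hPT ε x q₁ q₂ v₁ v₂ hx hline hq12 hv₁ hdet₁ hv₂ hdet₂
  haveI : FiniteDimensional (ZMod p) (SelQP W K p c {q₁, q₂} ε) := finiteDimensional_selQP W K p c _ ε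
  haveI : Finite (SelQP W K p c {q₁, q₂} ε) := Module.finite_of_finite (ZMod p)
  have h := FiniteField.pow_finrank_eq_natCard p (SelQP W K p c {q₁, q₂} ε)
  rw [hcard] at h
  exact Nat.pow_right_injective hp.two_le (h.trans (pow_one p).symm)

end Summit.BirchSwinnertonDyer.BirchSwinnertonDyer.Theorems.AdditiveKoly

end
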